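import Summits.ResolutionOfSingularities.ResolutionOfSingularities.Theorems.HilbertSamuelEliminationSigmaMaxModificationsCorridor3WLadderStrataBirthsTopDictionary
import Summits.ResolutionOfSingularities.ResolutionOfSingularities.Theorems.HilbertSamuelEliminationSigmaMaxModificationsCorridor3OriginAlongReaches
import HarnessLib

/-!
# [OURS · L1 W4.2] VACUITY CERTIFICATE: at an ISOLATED stage no `IsFibreBirthAt` event exists

Crux chain w42 (`SigmaMaxModifications`, stmt-ResolutionOfSingularities-18506; conjunct `SigmaMaxModificationsCorridor3`,
stmt-ResolutionOfSingularities-19249). Typer's vacuity check (res-L1-type-o1, OURS typer G4) of the object D17 «ALT LAW: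
TRANSITION LEMMA + NO-RECURRENCE ROW» (res-L1-w42-plan-1 RULINGS v3.12-4 (V), 2026-08-27T08:49:06Z), which was specified
over res-type-067's event `Moving.IsFibreBirthAt` (…WLadderStrataBirthsTopDictionary, p513551):

* D17 (i) «`Iso 3 (c m) → ¬ Iso 3 (c (m+1)) → … → ∃ Z', IsFibreBirthAt 3 ν (c m) (c (m+1)) f Z'`» and
* D17 (ii) «`NoRecurrentIsoPointBirth3` := eventually, at ISOLATED blown-up steps, `¬ ∃ Z', IsFibreBirthAt …`».

FINDING (kernel-checked below, pure topology + the tree's pointed-restart brick): `IsFibreBirthAt N ν s s' f Z'` requires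
`IsNewbornAt`, i.e. `closure (f '' Z') ∉ componentsIn (X_n(ν))` («does not dominate a component of `X_n(ν)`»), AND
`closure (f '' Z') = {x_n}`. But when `x_n` is ISOLATED in its stratum — an open `U ∋ x_n` with `U ∩ X_n(ν) = {x_n}`, which is
exactly what `Moving.Iso N s` gives at every stage reached from a maximal origin
(`IsMaximalOrigin.exists_isOpen_inter_hsStratum_eq_of_iso`, …Corridor3OriginAlongReaches) — the singleton `{x_n}` IS an
irreducible component of `X_n(ν)` (`singleton_mem_componentsIn_of_isOpen_inter_eq`; `x_n` closed). Hence every `Z'` collapsing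
to `x_n` DOMINATES the component `{x_n}` and is NOT newborn: **`¬ IsFibreBirthAt N ν s s' f Z'` for all `s'`, `f`, `Z'` at an
isolated reached stage** (`not_isFibreBirthAt_of_iso`). Consequences for D17 as specified: (i) is FALSE whenever its antecedent
is realised (iso → non-iso transitions do occur — RULINGS (V) itself describes them), and the row (ii) is TRUE BY LOGIC (vacuous
law), so the planned closer (iii) `WtopAltM ⟸ NoRecurrentIsoPointBirth3` cannot go through (i).

This is a statement about 067's event AT ISOLATED STEPS only. In 067's own scope (rows `StrataCycleEndNoFibreBirths` /
`…NoMovingBirths`: NEVER-isolated chains) `{x_n}` is never a component and `IsNewbornAt` is the right notion — nothing there is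
affected.

REPAIR PROPOSED (typer's suggestion, for plan-1 / the D17 hand to decide; NOT typed here): key the iso-step law to an event
WITHOUT the non-domination clause, e.g. `IsIsoStepBirthAt N ν s s' f Z' := Z' ∈ componentsThrough N ν s' ∧
closure (f.base '' Z') = {s.pt} ∧ Z'.Nontrivial` («a positive-dimensional component of `X_{n+1}(ν)` through `x_{n+1}` collapsing
to the isolated point `x_n`»); then (i) reads `Iso N (c m) → ¬ Iso N (c (m+1)) → StepProjection … f → ∃ Z', IsIsoStepBirthAt …`
(content: `¬ Iso` at a Noetherian stage ⇒ a non-singleton component through `x_{m+1}`; `H` does not increase under the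
permissible blow-up and `ν` is maximal ⇒ that component lies over `X_m(ν) ∩ U = {x_m}`), (ii) forbids `IsIsoStepBirthAt`
eventually at isolated blown-up steps (an honest OURS claim), and (iii) is the intended two-line logic.

OURS (cell res-hironaka, slot W4.2); NOT a statement of H. Hironaka's manuscript [Hironaka2017] nor of [CossartJannsenSaito2020];
AI-written, weaker than expert review. Helper file `--supports stmt-ResolutionOfSingularities-19249 --as helper` (counted 0);
theorem-only (no `def`), nothing asserted beyond what the kernel checks.
-/

noncomputable section

set_option linter.dupNamespace false

open CategoryTheory AlgebraicGeometry TopologicalSpace Topology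
open Summit.ResolutionOfSingularities.ResolutionOfSingularities.Theorems.CampaignW42
open Literature.AlgebraicGeometry.Resolution Literature.RingTheory.HilbertSamuel
open Literature.AlgebraicGeometry.CossartJannsenSaito2020
open Summit.ResolutionOfSingularities.ResolutionOfSingularities.Theorems.SigmaMaxModificationsCorridor3

universe u

/-! ## §1. Topology: an isolated CLOSED point of a subset is an irreducible component of it -/

section Topology

variable {X : Type u} [TopologicalSpace X] {S U : Set X} {x : X}

/-- If an open `U` cuts a subset `S` in exactly one CLOSED point `x`, then `{x}` is an irreducible component of `S`
(`componentsIn S`, the tree's components-of-a-subset). Proof: `{⟨x, _⟩}` is irreducible; an irreducible `T ∋ x` of the subspace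
`S` meeting `{x}ᶜ` would meet the two disjoint opens `U ∩ S = {x}` and `{x}ᶜ` simultaneously. [folklore] -/
theorem singleton_mem_componentsIn_of_isOpen_inter_eq (hU : IsOpen U) (hUS : U ∩ S = {x})
    (hx : IsClosed ({x} : Set X)) : ({x} : Set X) ∈ componentsIn S := by
  have hxS : x ∈ S := by
    have : x ∈ U ∩ S := by rw [hUS]; exact Set.mem_singleton x
    exact this.2
  let x' : S := ⟨x, hxS⟩
  have hT : ({x'} : Set S) ∈ irreducibleComponents S := by
    refine ⟨isIrreducible_singleton, fun T hT hxT => ?_⟩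
    -- `T` irreducible with `{x'} ⊆ T`; show `T ⊆ {x'}`
    intro y hy
    by_contra hne
    have hne' : (y : X) ≠ x := fun h => hne (Subtype.ext h)
    -- the two opens of the subspace
    have hu : IsOpen (((↑) : S → X) ⁻¹' U) := hU.preimage continuous_subtype_val
    have hv : IsOpen (((↑) : S → X) ⁻¹' ({x}ᶜ : Set X)) := hx.isOpen_compl.preimage continuous_subtype_val
    have hxU : x ∈ U := by
      have : x ∈ U ∩ S := by rw [hUS]; exact Set.mem_singleton x
      exact this.1
    obtain ⟨z, hzT, hzU, hzx⟩ := hT.isPreirreducible _ _ hu hv ⟨x', hxT (Set.mem_singleton _), hxU⟩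
      ⟨y, hy, hne'⟩
    have hz : (z : X) ∈ U ∩ S := ⟨hzU, z.2⟩
    rw [hUS] at hz
    exact hzx hz
  refine ⟨{x'}, hT, ?_⟩
  simp [x']

end Topology

namespace Summit.ResolutionOfSingularities.ResolutionOfSingularities.Theorems.SigmaMaxModificationsCorridor3.Moving

variable {R : ∀ S : Scheme.{u}, CentreSeq S → Prop} {p N : ℕ} {ν : ℕ → ℕ}

/-! ## §2. No `IsNewbornAt` / `IsFibreBirthAt` event over a stratum-isolated closed marked point -/

/-- If `{x_n}` is an irreducible component of `X_n(ν)`, nothing collapsing to `x_n` is newborn in 067's sense (it dominates the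
component `{x_n}`). [folklore] -/
theorem not_isNewbornAt_of_closure_image_eq {s s' : MarkedStage.{u}} {f : s'.W ⟶ s.W} {Z' : Set s'.W}
    (hpt : ({s.pt} : Set s.W) ∈ componentsIn (Scheme.hsStratum s.W N ν))
    (hZ' : closure (f.base '' Z') = {s.pt}) : ¬ IsNewbornAt N ν s s' f Z' := by
  rintro ⟨-, hdom⟩
  exact hdom (hZ' ▸ hpt)

/-- **No fibre birth over a stratum-isolated closed point**: if an open `U ∋ x_n` has `U ∩ X_n(ν) = {x_n}` and `x_n` is closed,
then `¬ IsFibreBirthAt N ν s s' f Z'` for every `s'`, `f`, `Z'`. [folklore] -/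
theorem not_isFibreBirthAt_of_isOpen_inter_eq {s s' : MarkedStage.{u}} {f : s'.W ⟶ s.W} {Z' : Set s'.W} {U : Set s.W}
    (hU : IsOpen U) (hUS : U ∩ Scheme.hsStratum s.W N ν = {s.pt}) (hcl : IsClosed ({s.pt} : Set s.W)) :
    ¬ IsFibreBirthAt N ν s s' f Z' := by
  rintro ⟨hnew, hZ'⟩
  exact not_isNewbornAt_of_closure_image_eq (singleton_mem_componentsIn_of_isOpen_inter_eq hU hUS hcl) hZ' hnew

/-- **VACUITY CERTIFICATE FOR D17 AS SPECIFIED**: at a stage `s` reached from a maximal origin (admissible oracle) with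
`Moving.Iso N s` (marked point isolated in the Hilbert–Samuel locus), there is NO `IsFibreBirthAt N ν s s' f Z'` event whatsoever
— for every next stage `s'`, every morphism `f` and every subset `Z'`. Hence «`∃ Z', IsFibreBirthAt …`» at an iso → non-iso
transition is unsatisfiable and «eventually no `IsFibreBirthAt` at isolated steps» holds by logic. [folklore] -/
theorem not_isFibreBirthAt_of_iso (hRa : OracleAdmissible R) {X : Scheme.{u}} [IsLocallyNoetherian X] {x : X}
    (hX : IsMaximalOrigin p N ν X x) {s : MarkedStage.{u}} (hs : Reaches R N ν (MarkedStage.init X x) s) (hiso : Iso N s)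
    (s' : MarkedStage.{u}) (f : s'.W ⟶ s.W) (Z' : Set s'.W) : ¬ IsFibreBirthAt N ν s s' f Z' := by
  obtain ⟨U, hU, -, hUS⟩ := hX.exists_isOpen_inter_hsStratum_eq_of_iso hRa hs hiso
  exact not_isFibreBirthAt_of_isOpen_inter_eq hU hUS (hX.of_reaches hRa hs).isClosed

/-- **Chain form** (the shape D17 quantifies over): along a chain `c` of canonical near steps from a maximal origin, at every
stage `c m` with `Iso N (c m)` there is no `IsFibreBirthAt N ν (c m) (c (m+1)) f Z'`. In particular the row
«`∃ n₁, ∀ n ≥ n₁, Iso N (c n) → (c n).IsBlownUp R N ν → ∀ f, StepProjection … f → ¬ ∃ Z', IsFibreBirthAt N ν (c n) (c (n+1)) f Z'`»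
holds with `n₁ = 0`, for every oracle, origin and chain. [folklore] -/
theorem not_isFibreBirthAt_along_chain_of_iso (hRa : OracleAdmissible R) {X : Scheme.{u}} [IsLocallyNoetherian X] {x : X}
    (hX : IsMaximalOrigin p N ν X x) {c : ℕ → MarkedStage.{u}} (h0 : Reaches R N ν (MarkedStage.init X x) (c 0))
    (hstep : ∀ n, CanonicalNearStep R N ν (c n) (c (n + 1))) {m : ℕ} (hiso : Iso N (c m))
    (f : (c (m + 1)).W ⟶ (c m).W) (Z' : Set (c (m + 1)).W) : ¬ IsFibreBirthAt N ν (c m) (c (m + 1)) f Z' := by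
  exact not_isFibreBirthAt_of_iso hRa hX (reaches_chain h0 hstep m) hiso _ f Z'

end Summit.ResolutionOfSingularities.ResolutionOfSingularities.Theorems.SigmaMaxModificationsCorridor3.Moving

end
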